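import Literature.NumberTheory.NumberFields.KurodaRelationSymmetricThreeAmbiguous
import Literature.NumberTheory.NumberFields.ClassGroupCoprimeGaloisDescentCongruence
import Literature.NumberTheory.IwasawaTheory.RestrictedTowerLayerSection
import Literature.NumberTheory.IwasawaTheory.ClassicalMuVanishesFiniteDescent
import Literature.NumberTheory.IwasawaTheory.ClassicalMuVanishesBoundedRankProofs
import Literature.NumberTheory.IwasawaTheory.ClassicalLambdaInvariant
import HarnessLib

set_option autoImplicit false

/-!
# The `S₃` relation up a cyclotomic `ℤ₂`-tower: `λ₂(L) = λ₂(L^{C₃}) + 2·λ₂(L^{C₂})` for an `S₃`-extension `L/F`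

Topic `NumberTheory/IwasawaTheory` (namespace = path).  THEOREM-ONLY file (no definition, no named fact, no `sorry`), written by
the prover seat `bsd-line-att-p3` g33 (cell `bsd-f1-sign2`, route `AlignedTransportAtTwo`, `--supports` stmt-BirchSwinnertonDyer-22298,
whose sextic carrier `ℚ(W[2])` is an `S₃`-extension of `ℚ` with cubic subfield `ℚ(β)` and quadratic resolvent `ℚ(√Δ_W)`; closes
nothing; BSD is proved for no curve here).

SETTING (Washington §13.1, the tree's restricted towers).  `F` a number field, `κ` a `ℤ₂`-extension of `F`, `L/F` finite Galois with
`κ ∘ res` onto, `σ, τ ∈ Gal(L/F)` with `σ³ = 1`, `τ² = 1`, `τσ = σ²τ`; `K = L^{⟨σ⟩}`, `k = L^{⟨τ⟩}`; `e_n(X)`, `r_n(X)` the exponent of `2` in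
the class number and the `2`-rank of the class group of the `n`-th layer of `X·F_∞/X` (`classNumberPExp`, `classGroupPRank` of `κ|_X`).
At layer `n` the section `s : Gal(L/F) ↪ Gal(L·F_n/F)` of `RestrictedTowerLayerSection.lean` carries `σ, τ` to an `S₃`-pair of
`Gal(L_n/F)` whose fixed fields are the layers `K_n`, `k_n`, and the number-field files
`NumberFields/KurodaRelationSymmetricThree(Ambiguous).lean` give, with `q = 2^m ≫ 0`,
`2^{e_n(L)} ρ² = 2^{e_n(K)} a²`, `2^{e_n(k)} ≤ 2^{r_n(k)} a`, `a ≤ 2^{r_n(L)} 2^{e_n(k)}`, `1 ≤ ρ ≤ 2^{r_n(K)}` (the last when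
`⟨σ,τ⟩ = Gal(L/F)` has order not divisible by `4` and `2 ∤ h(F_n)`).  Hence:

* §1 `classNumberPExp_symmetricThree_le` — **`e_n(L) ≤ e_n(K) + 2 e_n(k) + 2 r_n(L)`** (every `n`, no hypothesis on `F`);
  `classNumberPExp_symmetricThree_ge` — **`e_n(K) + 2 e_n(k) ≤ e_n(L) + 2 r_n(k) + 2 r_n(K)`** when `2 ∤ h(F_n)`, `⟨σ,τ⟩ = Gal(L/F)`,
  `4 ∤ [L:F]`.
* §2 `classicalLambda_symmetricThree` — **if the three towers over `L`, `K`, `k` have `μ = 0` (growth form) and `2 ∤ h(F_n)` for all `n`,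
  then `λ(L) = λ(K) + 2·λ(k)`** (bounded `2`-ranks under `μ = 0`, tree `exists_forall_classGroupPRank_le_of_classicalMuVanishes`; two
  affine functions of `n` at bounded distance have the same slope).  No structure theory of `Λ`-modules, no character theory: this is
  the `λ`-part of the Brauer–Kuroda relation `h(L) h(F)² ∼ h(K) h(k)²` of `S₃` at the prime `2 ∣ #S₃`, where the finite-level
  relation holds only up to the ambiguous/capitulation defect of the quadratic step `L/k` (exact `2`-part equality: [Bartel2012] Thm. 1.2,
  analytic, not used).

References: [Washington1997] §13.1, §13.3 (Prop. 13.23, Thm. 13.13); [Lemmermeyer1994] §1; [Bartel2012] Thm. 1.2; [NeukirchANT1999]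
Ch. III §1 Prop. (1.6); [Lang1990] Ch. 5 §1 Thm. 1.2, Ch. 13 §4.
-/

noncomputable section

open scoped NumberField Classical
open NumberField Field IntermediateField

namespace Literature.NumberTheory.IwasawaTheory

open Literature.NumberTheory.EllipticCurves Literature.NumberTheory.EllipticCurves.ZpExtension
  Literature.NumberTheory.GaloisRepresentations Literature.NumberTheory.NumberFields
  Literature.NumberTheory.NumberFields.KurodaSymmetricThree

variable {F : Type} [Field F] [NumberField F]

/-! ### §0 Transport -/

/-- `#G[q] = #H[q]` along a group isomorphism. [folklore] -/
private theorem natCard_torsion_eq_of_mulEquiv {G H : Type*} [CommGroup G] [CommGroup H] (e : G ≃* H) (q : ℕ) :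
    Nat.card {g : G // g ^ q = 1} = Nat.card {h : H // h ^ q = 1} :=
  Nat.card_congr (e.toEquiv.subtypeEquiv fun g => by
    show g ^ q = 1 ↔ (e g) ^ q = 1
    rw [← map_pow, e.map_eq_one_iff])

/-- In a finite commutative group whose order is prime to `p`, the `p^m`-torsion is trivial. [folklore] -/
private theorem eq_one_of_pow_prime_pow_eq_one_of_padicValNat_card_eq_zero {M : Type*} [CommGroup M] [Finite M] {p : ℕ}
    [hp : Fact p.Prime] (h0 : padicValNat p (Nat.card M) = 0) {m : ℕ} {d : M} (hd : d ^ p ^ m = 1) : d = 1 := by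
  have hnd : ¬ p ∣ Nat.card M := by
    rcases padicValNat.eq_zero_iff.mp h0 with h | h | h
    · exact absurd h hp.out.one_lt.ne'
    · exact absurd h Nat.card_pos.ne'
    · exact h
  have hcop : Nat.Coprime (p ^ m) (Nat.card M) := (hp.out.coprime_iff_not_dvd.mpr hnd).pow_left m
  have h1 : orderOf d ∣ Nat.gcd (p ^ m) (Nat.card M) := Nat.dvd_gcd (orderOf_dvd_of_pow_eq_one hd) (orderOf_dvd_natCard d)
  rw [hcop, Nat.dvd_one] at h1
  exact orderOf_eq_one_iff.mp h1

/-! ### §1 The layer-`n` sandwich -/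

/-- **The `S₃` sandwich at layer `n`.**  `κ` a `ℤ₂`-extension of `F`, `L/F` Galois with `κ ∘ res` onto, `σ³ = 1`, `τ² = 1`, `τσ = σ²τ` in
`Gal(L/F)`, `K = L^{⟨σ⟩}`, `k = L^{⟨τ⟩}`.  Then at every layer `n`:
(i) `e_n(L) ≤ e_n(K) + 2 e_n(k) + 2 r_n(L)`; and (ii) if moreover `⟨σ, τ⟩ = Gal(L/F)`, `4 ∤ [L : F]` and the `n`-th layer over `F = L^{Gal}`
has odd class number, then `e_n(K) + 2 e_n(k) ≤ e_n(L) + 2 r_n(k) + 2 r_n(K)`.  (`2^{e_n(L)} ρ² = 2^{e_n(K)} a²` for the `S₃`-pair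
`s σ, s τ` of `Gal(L_n/F)`, with the ambiguous-class bounds of `KurodaRelationSymmetricThreeAmbiguous`.)
[cite: Washington1997, §13.1] [cite: Lemmermeyer1994, §1] [cite: NeukirchANT1999, Ch. III §1 Prop. (1.6) (ii), (iv)] -/
theorem classNumberPExp_symmetricThree_sandwich (κ : ZpExtension F 2) (L : Type) [Field L] [NumberField L] [Algebra F L]
    [IsGalois F L] (hL : Function.Surjective (κ.toContinuousMonoidHom.comp (absGaloisRestrict F L)))
    {σ τ : L ≃ₐ[F] L} (hσ : σ ^ 3 = 1) (hτ : τ ^ 2 = 1) (hτσ : τ * σ = σ ^ 2 * τ)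
    (hK : Function.Surjective (κ.toContinuousMonoidHom.comp (absGaloisRestrict F ↥(fixedField (Subgroup.zpowers σ)))))
    (hk : Function.Surjective (κ.toContinuousMonoidHom.comp (absGaloisRestrict F ↥(fixedField (Subgroup.zpowers τ)))))
    (n : ℕ) :
    classNumberPExp (κ.restrict L hL) n ≤
        classNumberPExp (κ.restrict ↥(fixedField (Subgroup.zpowers σ)) hK) n +
          2 * classNumberPExp (κ.restrict ↥(fixedField (Subgroup.zpowers τ)) hk) n + 2 * classGroupPRank (κ.restrict L hL) n ∧
      (Subgroup.closure ({σ, τ} : Set (L ≃ₐ[F] L)) = ⊤ → ¬ 4 ∣ Module.finrank F L →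
        (∀ hT : Function.Surjective
            (κ.toContinuousMonoidHom.comp (absGaloisRestrict F ↥(fixedField (⊤ : Subgroup (L ≃ₐ[F] L))))),
          classNumberPExp (κ.restrict ↥(fixedField (⊤ : Subgroup (L ≃ₐ[F] L))) hT) n = 0) →
        classNumberPExp (κ.restrict ↥(fixedField (Subgroup.zpowers σ)) hK) n +
            2 * classNumberPExp (κ.restrict ↥(fixedField (Subgroup.zpowers τ)) hk) n ≤
          classNumberPExp (κ.restrict L hL) n + 2 * classGroupPRank (κ.restrict ↥(fixedField (Subgroup.zpowers τ)) hk) n +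
            2 * classGroupPRank (κ.restrict ↥(fixedField (Subgroup.zpowers σ)) hK) n) := by
  classical
  haveI : FiniteDimensional F L := Module.Finite.of_restrictScalars_finite ℚ F L
  set e : L →ₐ[F] AlgebraicClosure F := absEmbedding F L with he
  haveI := isGalois_fieldRange_sup_layer κ L e n
  haveI := finiteDimensional_fieldRange_sup_layer κ L e n
  haveI := numberField_fieldRange_sup_layer κ L e n
  obtain ⟨s, hs_inj, hfix, hcard⟩ := exists_section_fixedField_map_eq κ L hL n
  -- layers as number fields
  have layerNF : ∀ (X : Type) [Field X] [NumberField X] [Algebra F X]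
      (hX : Function.Surjective (κ.toContinuousMonoidHom.comp (absGaloisRestrict F X))),
      NumberField ↥((κ.restrict X hX).layer n) := by
    intro X _ _ _ hX
    haveI : FiniteDimensional X ↥((κ.restrict X hX).layer n) := (κ.restrict X hX).finiteDimensional_layer_holds n
    exact NumberField.of_module_finite X _
  haveI := layerNF L hL
  haveI := layerNF _ hK
  haveI := layerNF _ hk
  -- ring isomorphisms model ≃ layer
  have isoH : ∀ (H : Subgroup (L ≃ₐ[F] L))
      (hH : Function.Surjective (κ.toContinuousMonoidHom.comp (absGaloisRestrict F ↥(fixedField H)))),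
      Nonempty (↥((κ.restrict ↥(fixedField H) hH).layer n) ≃+* ↥(fixedField (H.map s))) := by
    intro H hH
    have e₁ : ↥(fixedField (H.map s)) ≃ₐ[F] ↥(IntermediateField.map e (fixedField H) ⊔ κ.layer n) :=
      (IntermediateField.liftAlgEquiv (fixedField (H.map s))).trans (IntermediateField.equivOfEq (hfix H))
    obtain ⟨e₂⟩ := nonempty_ringEquiv_layer_restrict_fieldRange_sup_layer κ ↥(fixedField H) hH (e.comp (fixedField H).val) n
    have e₃ : ↥((e.comp (fixedField H).val).fieldRange ⊔ κ.layer n) ≃ₐ[F] ↥(IntermediateField.map e (fixedField H) ⊔ κ.layer n) :=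
      IntermediateField.equivOfEq (by rw [IntermediateField.fieldRange_comp_val])
    exact ⟨e₂.trans (e₃.toRingEquiv.trans e₁.symm.toRingEquiv)⟩
  obtain ⟨eL⟩ := nonempty_ringEquiv_layer_restrict_fieldRange_sup_layer κ L hL e n
  obtain ⟨eK⟩ := isoH (Subgroup.zpowers σ) hK
  obtain ⟨ek⟩ := isoH (Subgroup.zpowers τ) hk
  -- the `S₃`-pair at layer `n`
  have hσ' : s σ ^ 3 = 1 := by rw [← map_pow, hσ, map_one]
  have hτ' : s τ ^ 2 = 1 := by rw [← map_pow, hτ, map_one]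
  have hτσ' : s τ * s σ = s σ ^ 2 * s τ := by rw [← map_mul, hτσ, map_mul, map_pow]
  -- a uniform torsion exponent `q = 2^m`
  obtain ⟨m, hm⟩ : ∃ m, m = classNumberPExp (κ.restrict L hL) n +
      classNumberPExp (κ.restrict ↥(fixedField (Subgroup.zpowers σ)) hK) n +
      classNumberPExp (κ.restrict ↥(fixedField (Subgroup.zpowers τ)) hk) n := ⟨_, rfl⟩
  have hq : Nat.Coprime 3 (2 ^ m) := Nat.Coprime.pow_right m (by norm_num)
  -- the relation and the ambiguous bounds, in `.map s` form
  have MAIN : Nat.card {c : ClassGroup (𝓞 ↥(e.fieldRange ⊔ κ.layer n)) // c ^ 2 ^ m = 1} *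
      Nat.card {c : ClassGroup (𝓞 ↥(e.fieldRange ⊔ κ.layer n)) // c ^ 2 ^ m = 1 ∧
        ClassGroup.mulEquiv (AmbiguousClass.intAut (s σ)) c = c ∧ ClassGroup.mulEquiv (AmbiguousClass.intAut (s τ)) c = c} ^ 2 =
      Nat.card {d : ClassGroup (𝓞 ↥(fixedField ((Subgroup.zpowers σ).map s))) // d ^ 2 ^ m = 1} *
      Nat.card {c : ClassGroup (𝓞 ↥(e.fieldRange ⊔ κ.layer n)) // c ^ 2 ^ m = 1 ∧
        ClassGroup.mulEquiv (AmbiguousClass.intAut (s τ)) c = c} ^ 2 := by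
    rw [MonoidHom.map_zpowers]
    exact card_torsion_classGroup_symmetricThree F _ (s σ) (s τ) hσ' hτ' hτσ' hq
  have UP : Nat.card {c : ClassGroup (𝓞 ↥(e.fieldRange ⊔ κ.layer n)) // c ^ 2 ^ m = 1 ∧
        ClassGroup.mulEquiv (AmbiguousClass.intAut (s τ)) c = c} ≤
      Nat.card {c : ClassGroup (𝓞 ↥(e.fieldRange ⊔ κ.layer n)) // c ^ 2 = 1} *
        Nat.card {d : ClassGroup (𝓞 ↥(fixedField ((Subgroup.zpowers τ).map s))) // d ^ 2 ^ m = 1} := by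
    rw [MonoidHom.map_zpowers]
    exact card_fixed_torsion_le F _ (s τ) hτ' (2 ^ m)
  have LOW : Nat.card {d : ClassGroup (𝓞 ↥(fixedField ((Subgroup.zpowers τ).map s))) // d ^ 2 ^ m = 1} ≤
      Nat.card {d : ClassGroup (𝓞 ↥(fixedField ((Subgroup.zpowers τ).map s))) // d ^ 2 = 1} *
        Nat.card {c : ClassGroup (𝓞 ↥(e.fieldRange ⊔ κ.layer n)) // c ^ 2 ^ m = 1 ∧
          ClassGroup.mulEquiv (AmbiguousClass.intAut (s τ)) c = c} := by
    rw [MonoidHom.map_zpowers]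
    exact card_torsion_fixedField_le F _ (s τ) hτ' (2 ^ m)
  -- numeric identifications
  have TL : Nat.card {c : ClassGroup (𝓞 ↥(e.fieldRange ⊔ κ.layer n)) // c ^ 2 ^ m = 1} =
      2 ^ classNumberPExp (κ.restrict L hL) n := by
    rw [← natCard_torsion_eq_of_mulEquiv (ClassGroup.mulEquiv (RingOfIntegers.mapRingEquiv eL)), classNumberPExp_def]
    exact natCard_torsion_pow_eq_pow_padicValNat (by rw [← classNumberPExp_def]; omega)
  have TK : Nat.card {d : ClassGroup (𝓞 ↥(fixedField ((Subgroup.zpowers σ).map s))) // d ^ 2 ^ m = 1} =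
      2 ^ classNumberPExp (κ.restrict ↥(fixedField (Subgroup.zpowers σ)) hK) n := by
    rw [← natCard_torsion_eq_of_mulEquiv (ClassGroup.mulEquiv (RingOfIntegers.mapRingEquiv eK)), classNumberPExp_def]
    exact natCard_torsion_pow_eq_pow_padicValNat (by rw [← classNumberPExp_def]; omega)
  have Tk : Nat.card {d : ClassGroup (𝓞 ↥(fixedField ((Subgroup.zpowers τ).map s))) // d ^ 2 ^ m = 1} =
      2 ^ classNumberPExp (κ.restrict ↥(fixedField (Subgroup.zpowers τ)) hk) n := by
    rw [← natCard_torsion_eq_of_mulEquiv (ClassGroup.mulEquiv (RingOfIntegers.mapRingEquiv ek)), classNumberPExp_def]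
    exact natCard_torsion_pow_eq_pow_padicValNat (by rw [← classNumberPExp_def]; omega)
  have RL : Nat.card {c : ClassGroup (𝓞 ↥(e.fieldRange ⊔ κ.layer n)) // c ^ 2 = 1} = 2 ^ classGroupPRank (κ.restrict L hL) n := by
    rw [← natCard_torsion_eq_of_mulEquiv (ClassGroup.mulEquiv (RingOfIntegers.mapRingEquiv eL)), classGroupPRank_def]
    exact natCard_torsion_eq_pow_padicValNat_card_quotient 2
  have RK : Nat.card {d : ClassGroup (𝓞 ↥(fixedField ((Subgroup.zpowers σ).map s))) // d ^ 2 = 1} =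
      2 ^ classGroupPRank (κ.restrict ↥(fixedField (Subgroup.zpowers σ)) hK) n := by
    rw [← natCard_torsion_eq_of_mulEquiv (ClassGroup.mulEquiv (RingOfIntegers.mapRingEquiv eK)), classGroupPRank_def]
    exact natCard_torsion_eq_pow_padicValNat_card_quotient 2
  have Rk : Nat.card {d : ClassGroup (𝓞 ↥(fixedField ((Subgroup.zpowers τ).map s))) // d ^ 2 = 1} =
      2 ^ classGroupPRank (κ.restrict ↥(fixedField (Subgroup.zpowers τ)) hk) n := by
    rw [← natCard_torsion_eq_of_mulEquiv (ClassGroup.mulEquiv (RingOfIntegers.mapRingEquiv ek)), classGroupPRank_def]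
    exact natCard_torsion_eq_pow_padicValNat_card_quotient 2
  -- abbreviations (by equations, not `set`: cheap syntactic rewriting)
  obtain ⟨ρ, hρ⟩ : ∃ ρ, ρ = Nat.card {c : ClassGroup (𝓞 ↥(e.fieldRange ⊔ κ.layer n)) // c ^ 2 ^ m = 1 ∧
    ClassGroup.mulEquiv (AmbiguousClass.intAut (s σ)) c = c ∧ ClassGroup.mulEquiv (AmbiguousClass.intAut (s τ)) c = c} := ⟨_, rfl⟩
  obtain ⟨a, ha⟩ : ∃ a, a = Nat.card {c : ClassGroup (𝓞 ↥(e.fieldRange ⊔ κ.layer n)) // c ^ 2 ^ m = 1 ∧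
    ClassGroup.mulEquiv (AmbiguousClass.intAut (s τ)) c = c} := ⟨_, rfl⟩
  obtain ⟨eL', heL⟩ : ∃ x, x = classNumberPExp (κ.restrict L hL) n := ⟨_, rfl⟩
  obtain ⟨eK', heK⟩ : ∃ x, x = classNumberPExp (κ.restrict ↥(fixedField (Subgroup.zpowers σ)) hK) n := ⟨_, rfl⟩
  obtain ⟨ek', hek⟩ : ∃ x, x = classNumberPExp (κ.restrict ↥(fixedField (Subgroup.zpowers τ)) hk) n := ⟨_, rfl⟩
  obtain ⟨rL', hrL⟩ : ∃ x, x = classGroupPRank (κ.restrict L hL) n := ⟨_, rfl⟩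
  obtain ⟨rK', hrK⟩ : ∃ x, x = classGroupPRank (κ.restrict ↥(fixedField (Subgroup.zpowers σ)) hK) n := ⟨_, rfl⟩
  obtain ⟨rk', hrk⟩ : ∃ x, x = classGroupPRank (κ.restrict ↥(fixedField (Subgroup.zpowers τ)) hk) n := ⟨_, rfl⟩
  rw [TL, TK, ← hρ, ← ha, ← heL, ← heK] at MAIN
  rw [RL, Tk, ← ha, ← hrL, ← hek] at UP
  rw [Tk, Rk, ← ha, ← hek, ← hrk] at LOW
  rw [← hrK] at RK
  rw [← heL, ← heK, ← hek, ← hrL, ← hrK, ← hrk]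
  have hρ1 : 1 ≤ ρ := by
    rw [hρ]
    haveI : Nonempty {c : ClassGroup (𝓞 ↥(e.fieldRange ⊔ κ.layer n)) // c ^ 2 ^ m = 1 ∧
        ClassGroup.mulEquiv (AmbiguousClass.intAut (s σ)) c = c ∧ ClassGroup.mulEquiv (AmbiguousClass.intAut (s τ)) c = c} :=
      ⟨⟨1, one_pow _, map_one _, map_one _⟩⟩
    exact Nat.card_pos
  refine ⟨?_, fun hgen h4 hF => ?_⟩
  · -- (i) `2^{eL} ≤ 2^{eL} ρ² = 2^{eK} a² ≤ 2^{eK} (2^{rL} 2^{ek})²`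
    have h1 : 2 ^ eL' ≤ 2 ^ (eK' + 2 * ek' + 2 * rL') := by
      calc 2 ^ eL' ≤ 2 ^ eL' * ρ ^ 2 := Nat.le_mul_of_pos_right _ (by positivity)
        _ = 2 ^ eK' * a ^ 2 := MAIN
        _ ≤ 2 ^ eK' * (2 ^ rL' * 2 ^ ek') ^ 2 := Nat.mul_le_mul_left _ (Nat.pow_le_pow_left UP 2)
        _ = 2 ^ (eK' + 2 * ek' + 2 * rL') := by ring
    exact (pow_le_pow_iff_right₀ (by norm_num : (1 : ℕ) < 2)).mp h1
  · -- (ii) `ρ ≤ 2^{rK}` over the odd-class-number base, then `2^{eK} (2^{ek})² ≤ 2^{eK} (2^{rk} a)² = 2^{2rk} 2^{eL} ρ²`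
    have hT := surjective_comp_absGaloisRestrict_of_tower κ ↥(fixedField (⊤ : Subgroup (L ≃ₐ[F] L))) L hL
    have hF0 := hF hT
    haveI := layerNF _ hT
    obtain ⟨eT⟩ := isoH ⊤ hT
    have hcl : Subgroup.closure ({s σ, s τ} : Set _) = (⊤ : Subgroup (L ≃ₐ[F] L)).map s := by
      rw [← hgen, MonoidHom.map_closure, Set.image_pair]
    have h4' : ¬ 4 ∣ Nat.card (Subgroup.closure ({s σ, s τ} : Set _)) := by
      rw [hcl, Subgroup.card_map_of_injective hs_inj, Subgroup.card_top, IsGalois.card_aut_eq_finrank]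
      exact h4
    have hq' : ∀ d : ClassGroup (𝓞 ↥(fixedField (Subgroup.closure ({s σ, s τ} : Set _)))), d ^ 2 ^ m = 1 → d = 1 := by
      rw [hcl]
      intro d hd
      have h0 : padicValNat 2 (Nat.card (ClassGroup (𝓞 ↥(fixedField ((⊤ : Subgroup (L ≃ₐ[F] L)).map s))))) = 0 := by
        rw [← Nat.card_congr (ClassGroup.mulEquiv (RingOfIntegers.mapRingEquiv eT)).toEquiv, ← classNumberPExp_def]
        exact hF0
      exact eq_one_of_pow_prime_pow_eq_one_of_padicValNat_card_eq_zero h0 hd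
    have RHO := card_fixed_torsion_le_card_two_torsion_fixedField F _ (s σ) (s τ) hσ' h4' hq'
    rw [← MonoidHom.map_zpowers, RK, ← hρ] at RHO
    have h2 : 2 ^ (eK' + 2 * ek') ≤ 2 ^ (eL' + 2 * rk' + 2 * rK') := by
      calc 2 ^ (eK' + 2 * ek') = 2 ^ eK' * (2 ^ ek') ^ 2 := by ring
        _ ≤ 2 ^ eK' * (2 ^ rk' * a) ^ 2 := Nat.mul_le_mul_left _ (Nat.pow_le_pow_left LOW 2)
        _ = (2 ^ rk') ^ 2 * (2 ^ eK' * a ^ 2) := by ring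
        _ = (2 ^ rk') ^ 2 * (2 ^ eL' * ρ ^ 2) := by rw [MAIN]
        _ ≤ (2 ^ rk') ^ 2 * (2 ^ eL' * (2 ^ rK') ^ 2) :=
            Nat.mul_le_mul_left _ (Nat.mul_le_mul_left _ (Nat.pow_le_pow_left RHO 2))
        _ = 2 ^ (eL' + 2 * rk' + 2 * rK') := by ring
    exact (pow_le_pow_iff_right₀ (by norm_num : (1 : ℕ) < 2)).mp h2

/-- **`e_n(L) ≤ e_n(L^{⟨σ⟩}) + 2 e_n(L^{⟨τ⟩}) + 2 r_n(L)`** at every layer of the cyclotomic `ℤ₂`-tower (the `S₃` relation up the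
tower, upper half). [cite: Washington1997, §13.1] [cite: Lemmermeyer1994, §1] -/
theorem classNumberPExp_symmetricThree_le (κ : ZpExtension F 2) (L : Type) [Field L] [NumberField L] [Algebra F L]
    [IsGalois F L] (hL : Function.Surjective (κ.toContinuousMonoidHom.comp (absGaloisRestrict F L)))
    {σ τ : L ≃ₐ[F] L} (hσ : σ ^ 3 = 1) (hτ : τ ^ 2 = 1) (hτσ : τ * σ = σ ^ 2 * τ)
    (hK : Function.Surjective (κ.toContinuousMonoidHom.comp (absGaloisRestrict F ↥(fixedField (Subgroup.zpowers σ)))))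
    (hk : Function.Surjective (κ.toContinuousMonoidHom.comp (absGaloisRestrict F ↥(fixedField (Subgroup.zpowers τ)))))
    (n : ℕ) :
    classNumberPExp (κ.restrict L hL) n ≤
      classNumberPExp (κ.restrict ↥(fixedField (Subgroup.zpowers σ)) hK) n +
        2 * classNumberPExp (κ.restrict ↥(fixedField (Subgroup.zpowers τ)) hk) n + 2 * classGroupPRank (κ.restrict L hL) n :=
  (classNumberPExp_symmetricThree_sandwich κ L hL hσ hτ hτσ hK hk n).1

/-- **`e_n(L^{⟨σ⟩}) + 2 e_n(L^{⟨τ⟩}) ≤ e_n(L) + 2 r_n(L^{⟨τ⟩}) + 2 r_n(L^{⟨σ⟩})`** at every layer whose base layer `F_n` has odd class number,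
for `Gal(L/F) = ⟨σ, τ⟩` of order not divisible by `4` (the `S₃` relation up the tower, lower half).
[cite: Washington1997, §13.1] [cite: Lemmermeyer1994, §1] -/
theorem classNumberPExp_symmetricThree_ge (κ : ZpExtension F 2) (L : Type) [Field L] [NumberField L] [Algebra F L]
    [IsGalois F L] (hL : Function.Surjective (κ.toContinuousMonoidHom.comp (absGaloisRestrict F L)))
    {σ τ : L ≃ₐ[F] L} (hσ : σ ^ 3 = 1) (hτ : τ ^ 2 = 1) (hτσ : τ * σ = σ ^ 2 * τ)
    (hgen : Subgroup.closure ({σ, τ} : Set (L ≃ₐ[F] L)) = ⊤) (h4 : ¬ 4 ∣ Module.finrank F L)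
    (hK : Function.Surjective (κ.toContinuousMonoidHom.comp (absGaloisRestrict F ↥(fixedField (Subgroup.zpowers σ)))))
    (hk : Function.Surjective (κ.toContinuousMonoidHom.comp (absGaloisRestrict F ↥(fixedField (Subgroup.zpowers τ)))))
    (n : ℕ)
    (hF : ∀ hT : Function.Surjective
        (κ.toContinuousMonoidHom.comp (absGaloisRestrict F ↥(fixedField (⊤ : Subgroup (L ≃ₐ[F] L))))),
      classNumberPExp (κ.restrict ↥(fixedField (⊤ : Subgroup (L ≃ₐ[F] L))) hT) n = 0) :
    classNumberPExp (κ.restrict ↥(fixedField (Subgroup.zpowers σ)) hK) n +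
        2 * classNumberPExp (κ.restrict ↥(fixedField (Subgroup.zpowers τ)) hk) n ≤
      classNumberPExp (κ.restrict L hL) n + 2 * classGroupPRank (κ.restrict ↥(fixedField (Subgroup.zpowers τ)) hk) n +
        2 * classGroupPRank (κ.restrict ↥(fixedField (Subgroup.zpowers σ)) hK) n :=
  (classNumberPExp_symmetricThree_sandwich κ L hL hσ hτ hτσ hK hk n).2 hgen h4 hF

/-! ### §2 The `λ`-invariants: `λ(L) = λ(L^{⟨σ⟩}) + 2 λ(L^{⟨τ⟩})` -/

/-- Two eventually affine integer sequences at bounded distance have the same slope: if `|l₁ n + ν₁ − (l₂ n + ν₂)| ≤ C` for all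
large `n` then `l₁ = l₂`. [folklore] -/
private theorem slope_eq_of_bounded_sub {l₁ l₂ : ℕ} {ν₁ ν₂ C : ℤ} {n₀ : ℕ}
    (h₁ : ∀ n : ℕ, n₀ ≤ n → (l₁ : ℤ) * n + ν₁ ≤ l₂ * n + ν₂ + C)
    (h₂ : ∀ n : ℕ, n₀ ≤ n → (l₂ : ℤ) * n + ν₂ ≤ l₁ * n + ν₁ + C) : l₁ = l₂ := by
  -- evaluate at a large `n`
  obtain ⟨n, hn0, hnC⟩ : ∃ n : ℕ, n₀ ≤ n ∧ C + |ν₁| + |ν₂| < n := by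
    refine ⟨n₀ + (C + |ν₁| + |ν₂|).toNat + 1, by omega, ?_⟩
    push_cast
    have := Int.self_le_toNat (C + |ν₁| + |ν₂|)
    omega
  have a1 := h₁ n hn0
  have a2 := h₂ n hn0
  have hν₁ := abs_nonneg ν₁
  have e1 := neg_abs_le ν₁
  have e2 := le_abs_self ν₁
  have e3 := neg_abs_le ν₂
  have e4 := le_abs_self ν₂
  rcases lt_trichotomy l₁ l₂ with h | h | h
  · exfalso
    have h' : (l₁ : ℤ) + 1 ≤ l₂ := by exact_mod_cast h
    have hn : (0 : ℤ) ≤ n := by positivity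
    nlinarith
  · exact h
  · exfalso
    have h' : (l₂ : ℤ) + 1 ≤ l₁ := by exact_mod_cast h
    have hn : (0 : ℤ) ≤ n := by positivity
    nlinarith

/-- ★ **`λ(L) = λ(L^{⟨σ⟩}) + 2·λ(L^{⟨τ⟩})` for an `S₃`-extension up a `ℤ₂`-tower.**  `κ` a `ℤ₂`-extension of `F` with `2 ∤ h(F_n)` for all
`n` (e.g. `F = ℚ`), `L/F` Galois with `Gal(L/F) = ⟨σ, τ⟩`, `σ³ = τ² = 1`, `τσ = σ²τ`, `4 ∤ [L:F]` (an `S₃`-extension), `κ ∘ res` onto;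
if the restricted towers over `L`, `K = L^{⟨σ⟩}` and `k = L^{⟨τ⟩}` all have `μ = 0` in growth form, then
`classicalLambda(κ|_L) = classicalLambda(κ|_K) + 2 · classicalLambda(κ|_k)` — the `λ`-part of the Brauer–Kuroda relation of
`S₃` at the prime `2`, from the layer sandwich and bounded `2`-ranks (no `Λ`-modules, no zeta functions).
[cite: Washington1997, §13.3 Prop. 13.23 and Thm. 13.13] [cite: Lemmermeyer1994, §1] [cite: Bartel2012, Thm. 1.2] -/
theorem classicalLambda_symmetricThree (κ : ZpExtension F 2) (L : Type) [Field L] [NumberField L] [Algebra F L]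
    [IsGalois F L] (hL : Function.Surjective (κ.toContinuousMonoidHom.comp (absGaloisRestrict F L)))
    {σ τ : L ≃ₐ[F] L} (hσ : σ ^ 3 = 1) (hτ : τ ^ 2 = 1) (hτσ : τ * σ = σ ^ 2 * τ)
    (hgen : Subgroup.closure ({σ, τ} : Set (L ≃ₐ[F] L)) = ⊤) (h4 : ¬ 4 ∣ Module.finrank F L)
    (hK : Function.Surjective (κ.toContinuousMonoidHom.comp (absGaloisRestrict F ↥(fixedField (Subgroup.zpowers σ)))))
    (hk : Function.Surjective (κ.toContinuousMonoidHom.comp (absGaloisRestrict F ↥(fixedField (Subgroup.zpowers τ)))))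
    (hF : ∀ (hT : Function.Surjective
        (κ.toContinuousMonoidHom.comp (absGaloisRestrict F ↥(fixedField (⊤ : Subgroup (L ≃ₐ[F] L)))))) (n : ℕ),
      classNumberPExp (κ.restrict ↥(fixedField (⊤ : Subgroup (L ≃ₐ[F] L))) hT) n = 0)
    (hμL : ClassicalMuVanishes (κ.restrict L hL))
    (hμK : ClassicalMuVanishes (κ.restrict ↥(fixedField (Subgroup.zpowers σ)) hK))
    (hμk : ClassicalMuVanishes (κ.restrict ↥(fixedField (Subgroup.zpowers τ)) hk)) :
    classicalLambda (κ.restrict L hL) =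
      classicalLambda (κ.restrict ↥(fixedField (Subgroup.zpowers σ)) hK) +
        2 * classicalLambda (κ.restrict ↥(fixedField (Subgroup.zpowers τ)) hk) := by
  obtain ⟨BL, hBL⟩ := exists_forall_classGroupPRank_le_of_classicalMuVanishes _ hμL
  obtain ⟨BK, hBK⟩ := exists_forall_classGroupPRank_le_of_classicalMuVanishes _ hμK
  obtain ⟨Bk, hBk⟩ := exists_forall_classGroupPRank_le_of_classicalMuVanishes _ hμk
  obtain ⟨νL, nL, hνL⟩ := classicalLambda_spec _ hμL
  obtain ⟨νK, nK, hνK⟩ := classicalLambda_spec _ hμK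
  obtain ⟨νk, nk, hνk⟩ := classicalLambda_spec _ hμk
  set lL := classicalLambda (κ.restrict L hL)
  set lK := classicalLambda (κ.restrict ↥(fixedField (Subgroup.zpowers σ)) hK)
  set lk := classicalLambda (κ.restrict ↥(fixedField (Subgroup.zpowers τ)) hk)
  have key : ∀ n : ℕ, max nL (max nK nk) ≤ n →
      ((lL : ℤ) * n + νL ≤ (lK + 2 * lk : ℕ) * n + (νK + 2 * νk) + 2 * (BL + BK + Bk : ℕ)) ∧
      (((lK + 2 * lk : ℕ) : ℤ) * n + (νK + 2 * νk) ≤ lL * n + νL + 2 * (BL + BK + Bk : ℕ)) := by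
    intro n hn
    have hnL : nL ≤ n := le_trans (le_max_left _ _) hn
    have hnK : nK ≤ n := le_trans (le_trans (le_max_left _ _) (le_max_right _ _)) hn
    have hnk : nk ≤ n := le_trans (le_trans (le_max_right _ _) (le_max_right _ _)) hn
    have s1 := (classNumberPExp_symmetricThree_sandwich κ L hL hσ hτ hτσ hK hk n).1
    have s2 := (classNumberPExp_symmetricThree_sandwich κ L hL hσ hτ hτσ hK hk n).2 hgen h4 (fun hT => hF hT n)
    have s1' : (classNumberPExp (κ.restrict L hL) n : ℤ) ≤
        classNumberPExp (κ.restrict ↥(fixedField (Subgroup.zpowers σ)) hK) n +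
          2 * classNumberPExp (κ.restrict ↥(fixedField (Subgroup.zpowers τ)) hk) n +
          2 * classGroupPRank (κ.restrict L hL) n := by exact_mod_cast s1
    have s2' : (classNumberPExp (κ.restrict ↥(fixedField (Subgroup.zpowers σ)) hK) n : ℤ) +
        2 * classNumberPExp (κ.restrict ↥(fixedField (Subgroup.zpowers τ)) hk) n ≤
        classNumberPExp (κ.restrict L hL) n +
          2 * classGroupPRank (κ.restrict ↥(fixedField (Subgroup.zpowers τ)) hk) n +
          2 * classGroupPRank (κ.restrict ↥(fixedField (Subgroup.zpowers σ)) hK) n := by exact_mod_cast s2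
    have r1 : (classGroupPRank (κ.restrict L hL) n : ℤ) ≤ BL := by exact_mod_cast hBL n
    have r2 : (classGroupPRank (κ.restrict ↥(fixedField (Subgroup.zpowers σ)) hK) n : ℤ) ≤ BK := by exact_mod_cast hBK n
    have r3 : (classGroupPRank (κ.restrict ↥(fixedField (Subgroup.zpowers τ)) hk) n : ℤ) ≤ Bk := by exact_mod_cast hBk n
    rw [hνL n hnL, hνK n hnK, hνk n hnk] at s1' s2'
    push_cast
    constructor <;> nlinarith
  have := slope_eq_of_bounded_sub (l₁ := lL) (l₂ := lK + 2 * lk) (ν₁ := νL) (ν₂ := νK + 2 * νk)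
    (C := 2 * ((BL + BK + Bk : ℕ) : ℤ)) (n₀ := max nL (max nK nk)) (fun n hn => (key n hn).1) (fun n hn => (key n hn).2)
  exact this

end Literature.NumberTheory.IwasawaTheory

end
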